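import Literature.MathematicalPhysics.QuantumFieldTheory.Balaban1983to89.B9Thm313WholeDvHolderFromDds

/-!
# `Balaban1983to89.B9Thm313WholeDvHolderFromDdsFree` — [B9] Theorems 3.12–3.13 (pp. 420–426): the Hölder-source members of the D_U-orbit of rows 20–21
# (∇_{U,ν}G₀D_U, ∇_UG₀D_U, Φ^Y_β∘∇_UG₀D_U) from LENGTH-FREE letters — the directional (3.44)∕(3.45) members displayed PRINT-LITERALLY (`bHX → 𝔠⁽¹⁾`,
# `bHX → 𝔠_P^{(β−1)}`) and a length-free `J`-letter, as at the print-weighted pins (P1′)(P2′) of `B9SmoothHolderClassP`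

T. Bałaban, *Propagators for lattice gauge theories in a background field*, Commun. Math. Phys. **99** (1985) 389–434
[`Balaban1985BackgroundPropagators`, "B9"]; [4] = T. Bałaban, *Propagators and renormalization transformations for lattice gauge
theories. II*, Commun. Math. Phys. **96** (1984) 223–250 [`Balaban1984PropagatorsII`].

statement-level skeleton of published theorems with citation tags; proofs where landed; nothing here is a claim about the
Yang–Mills mass gap

THE PRINTED LOCI.  [B9] Thm 3.1 (3.44)–(3.45) p. 398 (*"|(∇_UG′(U)∇\*_Uλ)(x)| ≦ B′₀(ε)e^{−δ₀d}(‖λ‖^{ξ′}_ε + |λ|)"*, *"‖ζ∇_UG′(U)∇\*_Uλ‖_β ≦ B′₀(ε,β)(Lʲη)^{−β}(…)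
(‖λ‖^{ξ′}_{β+ε} + |λ|)"*), Thm 3.3 p. 399 (the same for `G(U)`), (3.3) p. 390 (`D_U = Σ_μ ∇\*_{U,μ}∘J_μ` in coordinates), Thm 3.13 (3.152)–(3.153) p. 426;
[4] (2.52)–(2.56) pp. 232–233, Lemma 2.1 (2.61) p. 234.

WHY THIS FILE (cell `pub-ymgap`, node N06, seat dag-n06-l g24; step (R4′) of repair (A′), `BH13-UNITS-MEMO.md`).  `B9Thm313WholeDvHolderFromDds` (g18) composes the
D_U-orbit consumers from directional members INTO THE SHARP BLOCKS (`ofBlocks`, dimension 0) and a `J`-letter carrying ONE LENGTH (`C_J·(Lʲη)·e^{−δd}`) — the shape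
forced by the `(Lʲη)⁻¹`-weighted pin (P2).  At the PRINT-WEIGHTED pins the intermediate class certifies length-dimension 1 itself, so the displayed members are
print-literal — `∇_{U,ν}G₀∇\*_{U,μ} : bHX → 𝔠⁽¹⁾` ((3.44)), `Φ^Y_β∘∇_U∘G₀∘∇\*_{U,μ} : bHX → 𝔠_{P_Y}^{(β−1)}` ((3.45)) — and the `J`-letter is length-free
(`B9GradViaDivLettersPrintWeight.hasMaj_JcoKH_printGraded`).  THIS FILE gives the corresponding compositions, GENERIC in the classes `bH`, `bHX` (the «second halves»
of the g18 proofs, with the rescaled middle class replaced by `bHX` itself):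
* ★★ `dgDHd_of_h44m_one` — `∇_{U,ν}G₀D_U : bH → 𝔠⁽¹⁾` from `h44m1 : ∀ μ, ∇_{U,ν}G₀∇\*_{U,μ} : bHX → 𝔠⁽¹⁾` (`B_i·e^{−δ₀d}`) and `hJ : ∀ μ, J_μ : bH → bHX` (`C_J·e^{−δ_J d}`):
  any `B₃ ≥ |P|·κ₀·B_i·C_J·c`, rate `0 ≤ δ₃ ≤ δ₀`, `δ₃ + σ ≤ δ_J` ([4] (2.54) + (2.61) per μ, one sum);
* ★★ `dgDH_of_h44m_one` — `∇_UG₀D_U : bH → 𝔠_Y⁽¹⁾` with the slice-diagonal `∇_U = Σ_ν Π_ν∘∇_{U,ν}` (one more row sum);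
* ★★ `pYDH_of_h45Y_one` — `Φ^Y_β∘∇_U∘G₀∘D_U : bH → 𝔠_{P_Y}^{(β−1)}` from `h45Y1 : ∀ μ, … : bHX → 𝔠_{P_Y}^{(β−1)}` (`B_i·e^{−δ₀d}`) and the length-free `J`-letter;
* (D\*G₀D_U: `B9Thm313WholeDvHolderFromDds.h44DsDv_of_h44Ds` is already length-free and applies verbatim at the print-weighted pins.)
HONEST SCOPE.  Kernel bookkeeping over landed modules; the directional members and the J-letter are HYPOTHESES of printed species; nothing of [B9]∕[4] asserted;
no pin, no certificate edit; COUNT-NEUTRAL; N06 NOT discharged; nothing continuum, nothing about the mass gap.  Cell `pub-ymgap` (HUMAN RULING D-0062), Track A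
node N06 [B9], seat `pub-ymgap-dag-n06-l` (g24), 2026-08-29.
-/

namespace Literature.MathematicalPhysics.QuantumFieldTheory.Balaban1983to89.B9Thm313WholeDvHolderFromDdsFree

open Literature.MathematicalPhysics.QuantumFieldTheory.Balaban1983to89
open Finset B6RandomWalk B6RandomWalkHom B9Thm34Ext B11SectG B9SectDSup B9SectDL2Decay B9Thm37Glue B9Thm312Whole
open B9Thm312WholeClasses B9RWSums343to347Whole B9PerturbationMajorantAlgebra

noncomputable section

variable {g : B9.Geometry} {X Y W P : Type} [Fintype X] [Fintype Y] [Fintype W] [Fintype P] [Fintype g.Site]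
variable {R₀ : ℝ} {H₀ : Prop}

/-- Pre-composition distributes over finite sums of linear maps (private plumbing). [folklore] -/
private theorem fsum_comp' {ι M N K : Type} [AddCommGroup M] [Module ℝ M] [AddCommGroup N] [Module ℝ N] [AddCommGroup K] [Module ℝ K]
    (s : Finset ι) (A : M →ₗ[ℝ] N) (T : ι → N →ₗ[ℝ] K) : (∑ i ∈ s, T i) ∘ₗ A = ∑ i ∈ s, T i ∘ₗ A := by
  apply LinearMap.ext
  intro f
  simp only [LinearMap.comp_apply, LinearMap.sum_apply]

/-! ## §1 ∇_{U,ν}G₀D_U and ∇_UG₀D_U from print-literal (3.44) members and a length-free J-letter -/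

omit [Fintype Y] [Fintype W] in
/-- ★★ **∇_{U,ν}G₀D_U : bH → 𝔠⁽¹⁾ (`Letters313DMZ.dgDHd ν`) FROM PRINT-LITERAL (3.44) MEMBERS AND A LENGTH-FREE J-LETTER**: if every `∇_{U,ν}G₀∇\*_{U,μ}` maps the
intermediate class `bHX` into 𝔠⁽¹⁾ with `B_i·e^{−δ₀d}` ((3.44) read at a class certifying length-dimension 1, e.g. `bHZKP (taxiB U) s`) and every `J_μ : bH → bHX` has
`C_J·e^{−δ_J d}` (cutting cost `κ_X ≤ κ₀` of `bHX`), then `∇_{U,ν}G₀D_U = Σ_μ (∇_{U,ν}G₀∇\*_{U,μ})∘J_μ : bH → 𝔠⁽¹⁾` with any `B₃ ≥ |P|·κ₀·B_i·C_J·c`, rate `0 ≤ δ₃ ≤ δ₀`,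
`δ₃ + σ ≤ δ_J`. [cite: Balaban1985BackgroundPropagators, Thm 3.3 (3.44) p.398 + (3.152)–(3.153) p.426 + (3.3) p.390; Balaban1984PropagatorsII, (2.26) p.228 + (2.52)–(2.56) pp.232–233 + Lemma 2.1 (2.61) p.234] -/
theorem dgDHd_of_h44m_one (hG : GeoOK g) {σ c : ℝ} (hrow : RowSum (toB6 g R₀ H₀) σ c)
    {bH : BlockNorm (toB6 g R₀ H₀) (W → ℝ)} {bHX : BlockNorm (toB6 g R₀ H₀) (X → ℝ)} {blk : X → g.Site}
    {G0 : Module.End ℝ (X → ℝ)} {Dds : P → Module.End ℝ (X → ℝ)} {Ddν : Module.End ℝ (X → ℝ)}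
    {J : P → (W → ℝ) →ₗ[ℝ] (X → ℝ)} {Dv : (W → ℝ) →ₗ[ℝ] (X → ℝ)} {Bi δ₀ CJ δJ κ₀ B₃ δ₃ : ℝ}
    (hBi : 0 ≤ Bi) (hCJ : 0 ≤ CJ) (hc : 0 ≤ c) (hκ : bHX.κ ≤ κ₀) (hδ₃ : 0 ≤ δ₃) (hδ₃0 : δ₃ ≤ δ₀) (hδ₃J : δ₃ + σ ≤ δJ)
    (hB₃ : (Fintype.card P : ℝ) * (κ₀ * Bi * CJ * c) ≤ B₃)
    (hDv : Dv = ∑ μ, Dds μ ∘ₗ J μ)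
    (h44m1 : ∀ μ, HasMaj bHX (cNorm R₀ H₀ blk hG.lenle 1) (Ddν ∘ₗ (G0 ∘ₗ Dds μ)) (fun a b => Bi * Real.exp (-(δ₀ * g.dist a b))))
    (hJ : ∀ μ, HasMaj bH bHX (J μ) (fun a b => CJ * Real.exp (-(δJ * g.dist a b)))) :
    HasMaj bH (cNorm R₀ H₀ blk hG.lenle 1) (Ddν ∘ₗ G0 ∘ₗ Dv) (fun a b => B₃ * Real.exp (-(δ₃ * g.dist a b))) := by
  have htri : Triangle254 (toB6 g R₀ H₀) := fun a b c => hG.tri a b c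
  have hsym : DistSymm (toB6 g R₀ H₀) := fun a b => hG.symm a b
  have h3 : ∀ μ ∈ (Finset.univ : Finset P), HasMaj bH (cNorm R₀ H₀ blk hG.lenle 1) ((Ddν ∘ₗ (G0 ∘ₗ Dds μ)) ∘ₗ J μ)
      (fun a b => κ₀ * Bi * CJ * c * Real.exp (-(δ₃ * g.dist a b))) := by
    intro μ _
    refine (hasMaj_comp_exp_mirror hsym htri hG.dnn hrow hBi hCJ hδ₃ hδ₃0 hδ₃J (h44m1 μ) (hJ μ)).mono fun a b => ?_
    rw [toB6_dist]
    have hk1 : bHX.κ * Bi * CJ * c ≤ κ₀ * Bi * CJ * c :=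
      mul_le_mul_of_nonneg_right (mul_le_mul_of_nonneg_right (mul_le_mul_of_nonneg_right hκ hBi) hCJ) hc
    exact mul_le_mul_of_nonneg_right hk1 (Real.exp_nonneg _)
  rw [B9Thm313WholeDvHolderFromDds.comp_comp_dv_eq_fsum hDv G0 Ddν]
  refine (B9Thm313WholeDvFromDds.hasMaj_fsum_const _ _ _ h3).mono fun a b => ?_
  rw [Finset.card_univ]
  calc (Fintype.card P : ℝ) * (κ₀ * Bi * CJ * c * Real.exp (-(δ₃ * g.dist a b)))
      = (Fintype.card P : ℝ) * (κ₀ * Bi * CJ * c) * Real.exp (-(δ₃ * g.dist a b)) := by ring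
    _ ≤ B₃ * Real.exp (-(δ₃ * g.dist a b)) := mul_le_mul_of_nonneg_right hB₃ (Real.exp_nonneg _)

omit [Fintype W] in
/-- ★★ **∇_UG₀D_U : bH → 𝔠_Y⁽¹⁾ (`Letters313DZ.dgDH`)** with the slice-diagonal `∇_U = Σ_ν Π_ν∘∇_{U,ν}` (`hD`; `Π_ν : 𝔠⁽¹⁾ → 𝔠_Y⁽¹⁾` with `C_Π·e^{−δ_Π d}`), from the
print-literal members `h44m1 ν μ` and the length-free J-letter: `dgDHd_of_h44m_one` per ν and one more row sum give any `B₃′ ≥ |P|·C_Π·B₃·c`, `0 ≤ δ₃′ ≤ δ₃`, `δ₃′ + σ ≤ δ_Π`.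
[cite: Balaban1985BackgroundPropagators, Thm 3.3 (3.44) p.398 + (3.42) p.397 + (3.152)–(3.153) p.426; Balaban1984PropagatorsII, (2.52)–(2.56) pp.232–233 + Lemma 2.1 (2.61) p.234] -/
theorem dgDH_of_h44m_one (hG : GeoOK g) {σ c : ℝ} (hrow : RowSum (toB6 g R₀ H₀) σ c)
    {bH : BlockNorm (toB6 g R₀ H₀) (W → ℝ)} {bHX : BlockNorm (toB6 g R₀ H₀) (X → ℝ)} {blk : X → g.Site} {blkY : Y → g.Site}
    {G0 : Module.End ℝ (X → ℝ)} {Dd Dds : P → Module.End ℝ (X → ℝ)} {Pr : P → (X → ℝ) →ₗ[ℝ] (Y → ℝ)} {D : (X → ℝ) →ₗ[ℝ] (Y → ℝ)}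
    {J : P → (W → ℝ) →ₗ[ℝ] (X → ℝ)} {Dv : (W → ℝ) →ₗ[ℝ] (X → ℝ)} {Bi δ₀ CJ δJ κ₀ Cpr δpr B₃ δ₃ B₃' δ₃' : ℝ}
    (hBi : 0 ≤ Bi) (hCJ : 0 ≤ CJ) (hCpr : 0 ≤ Cpr) (hc : 0 ≤ c) (hκ : bHX.κ ≤ κ₀) (hδ₃ : 0 ≤ δ₃) (hδ₃0 : δ₃ ≤ δ₀) (hδ₃J : δ₃ + σ ≤ δJ)
    (hB₃ : (Fintype.card P : ℝ) * (κ₀ * Bi * CJ * c) ≤ B₃) (hδ₃' : 0 ≤ δ₃') (hδ₃'₃ : δ₃' ≤ δ₃) (hδ₃'pr : δ₃' + σ ≤ δpr)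
    (hB₃' : (Fintype.card P : ℝ) * (Cpr * B₃ * c) ≤ B₃')
    (hDv : Dv = ∑ μ, Dds μ ∘ₗ J μ) (hD : D = ∑ ν, Pr ν ∘ₗ Dd ν)
    (h44m1 : ∀ ν μ, HasMaj bHX (cNorm R₀ H₀ blk hG.lenle 1) (Dd ν ∘ₗ (G0 ∘ₗ Dds μ)) (fun a b => Bi * Real.exp (-(δ₀ * g.dist a b))))
    (hJ : ∀ μ, HasMaj bH bHX (J μ) (fun a b => CJ * Real.exp (-(δJ * g.dist a b))))
    (hPr : ∀ ν, HasMaj (cNorm R₀ H₀ blk hG.lenle 1) (cNorm R₀ H₀ blkY hG.lenle 1) (Pr ν) (fun a b => Cpr * Real.exp (-(δpr * g.dist a b)))) :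
    HasMaj bH (cNorm R₀ H₀ blkY hG.lenle 1) (D ∘ₗ G0 ∘ₗ Dv) (fun a b => B₃' * Real.exp (-(δ₃' * g.dist a b))) := by
  have htri : Triangle254 (toB6 g R₀ H₀) := fun a b c => hG.tri a b c
  have hB₃0 : 0 ≤ B₃ :=
    le_trans (mul_nonneg (Nat.cast_nonneg _) (mul_nonneg (mul_nonneg (mul_nonneg (le_trans bHX.κ_nonneg hκ) hBi) hCJ) hc)) hB₃
  have heq : D ∘ₗ G0 ∘ₗ Dv = ∑ ν, Pr ν ∘ₗ (Dd ν ∘ₗ G0 ∘ₗ Dv) := by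
    rw [hD, fsum_comp']
    rfl
  have hin : ∀ ν, HasMaj bH (cNorm R₀ H₀ blk hG.lenle 1) (Dd ν ∘ₗ G0 ∘ₗ Dv) (fun a b => B₃ * Real.exp (-(δ₃ * g.dist a b))) := fun ν =>
    dgDHd_of_h44m_one hG hrow hBi hCJ hc hκ hδ₃ hδ₃0 hδ₃J hB₃ hDv (h44m1 ν) hJ
  have h2 : ∀ ν ∈ (Finset.univ : Finset P), HasMaj bH (cNorm R₀ H₀ blkY hG.lenle 1) (Pr ν ∘ₗ (Dd ν ∘ₗ G0 ∘ₗ Dv))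
      (fun a b => Cpr * B₃ * c * Real.exp (-(δ₃' * g.dist a b))) := by
    intro ν _
    refine (hasMaj_comp_exp htri hG.dnn hrow hCpr hB₃0 hδ₃' hδ₃'₃ hδ₃'pr (hPr ν) (hin ν)).mono fun a b => le_of_eq ?_
    simp only [cNorm_κ, toB6_dist]
    ring
  rw [heq]
  refine (B9Thm313WholeDvFromDds.hasMaj_fsum_const _ _ _ h2).mono fun a b => ?_
  rw [Finset.card_univ]
  calc (Fintype.card P : ℝ) * (Cpr * B₃ * c * Real.exp (-(δ₃' * g.dist a b)))
      = (Fintype.card P : ℝ) * (Cpr * B₃ * c) * Real.exp (-(δ₃' * g.dist a b)) := by ring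
    _ ≤ B₃' * Real.exp (-(δ₃' * g.dist a b)) := mul_le_mul_of_nonneg_right hB₃' (Real.exp_nonneg _)

/-! ## §2 Φ^Y_β∘∇_U∘G₀∘D_U from print-literal (3.45) members and a length-free J-letter -/

omit [Fintype X] [Fintype Y] [Fintype W] in
/-- ★★ **Φ^Y_β∘∇_U∘G₀∘D_U : bH → 𝔠_{P_Y}^{(β−1)} (`Letters313HZ.pYDH β`) FROM PRINT-LITERAL (3.45) MEMBERS AND A LENGTH-FREE J-LETTER**: if every
`Φ^Y_β∘∇_U∘G₀∘∇\*_{U,μ}` maps `bHX` into `𝔠_{P_Y}^{(β−1)}` with `B_i·e^{−δ₀d}` ((3.45): `‖·‖_β ≲ (Lʲη)^{−β}(‖λ‖^{ξ′}_{β+ε} + |λ|)`, a unit of the print-weighted class having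
`‖λ‖^{ξ′} + |λ| ≤ 2Lʲ′η`) and every `J_μ : bH → bHX` has `C_J·e^{−δ_J d}`, then any `BhD ≥ |P|·κ₀·B_i·C_J·c`, `0 ≤ δ₃ ≤ δ₀`, `δ₃ + σ ≤ δ_J` serve.
[cite: Balaban1985BackgroundPropagators, Thm 3.13 p.426 + (3.45) p.398 + (3.152)–(3.153) p.426 + (3.3) p.390; Balaban1984PropagatorsII, (2.26) p.228 + (2.52)–(2.56) pp.232–233 + Lemma 2.1 (2.61) p.234] -/
theorem pYDH_of_h45Y_one (hG : GeoOK g) {σ c : ℝ} (hrow : RowSum (toB6 g R₀ H₀) σ c)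
    {PY : Type} [Fintype PY] {bW : BlockNorm (toB6 g R₀ H₀) (W → ℝ)} {bHX : BlockNorm (toB6 g R₀ H₀) (X → ℝ)} {blkPY : PY → g.Site}
    {G0 : Module.End ℝ (X → ℝ)} {Dds : P → Module.End ℝ (X → ℝ)} {D : (X → ℝ) →ₗ[ℝ] (Y → ℝ)} {ΦY : (Y → ℝ) →ₗ[ℝ] (PY → ℝ)}
    {J : P → (W → ℝ) →ₗ[ℝ] (X → ℝ)} {Dv : (W → ℝ) →ₗ[ℝ] (X → ℝ)} {β Bi δ₀ CJ δJ κ₀ BhD δ₃ : ℝ}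
    (hBi : 0 ≤ Bi) (hCJ : 0 ≤ CJ) (hc : 0 ≤ c) (hκ : bHX.κ ≤ κ₀) (hδ₃ : 0 ≤ δ₃) (hδ₃0 : δ₃ ≤ δ₀) (hδ₃J : δ₃ + σ ≤ δJ)
    (hBhD : (Fintype.card P : ℝ) * (κ₀ * Bi * CJ * c) ≤ BhD)
    (hDv : Dv = ∑ μ, Dds μ ∘ₗ J μ)
    (h45Y1 : ∀ μ, HasMaj bHX (cNormR R₀ H₀ blkPY hG.lenle (β - 1)) (ΦY ∘ₗ (D ∘ₗ (G0 ∘ₗ Dds μ))) (fun a b => Bi * Real.exp (-(δ₀ * g.dist a b))))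
    (hJ : ∀ μ, HasMaj bW bHX (J μ) (fun a b => CJ * Real.exp (-(δJ * g.dist a b)))) :
    HasMaj bW (cNormR R₀ H₀ blkPY hG.lenle (β - 1)) ((ΦY ∘ₗ D ∘ₗ G0) ∘ₗ Dv) (fun a b => BhD * Real.exp (-(δ₃ * g.dist a b))) := by
  have htri : Triangle254 (toB6 g R₀ H₀) := fun a b c => hG.tri a b c
  have hsym : DistSymm (toB6 g R₀ H₀) := fun a b => hG.symm a b
  have h3 : ∀ μ ∈ (Finset.univ : Finset P), HasMaj bW (cNormR R₀ H₀ blkPY hG.lenle (β - 1)) ((ΦY ∘ₗ (D ∘ₗ (G0 ∘ₗ Dds μ))) ∘ₗ J μ)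
      (fun a b => κ₀ * Bi * CJ * c * Real.exp (-(δ₃ * g.dist a b))) := by
    intro μ _
    refine (hasMaj_comp_exp_mirror hsym htri hG.dnn hrow hBi hCJ hδ₃ hδ₃0 hδ₃J (h45Y1 μ) (hJ μ)).mono fun a b => ?_
    rw [toB6_dist]
    have hk1 : bHX.κ * Bi * CJ * c ≤ κ₀ * Bi * CJ * c :=
      mul_le_mul_of_nonneg_right (mul_le_mul_of_nonneg_right (mul_le_mul_of_nonneg_right hκ hBi) hCJ) hc
    exact mul_le_mul_of_nonneg_right hk1 (Real.exp_nonneg _)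
  have heq : (ΦY ∘ₗ D ∘ₗ G0) ∘ₗ Dv = ∑ μ, (ΦY ∘ₗ (D ∘ₗ (G0 ∘ₗ Dds μ))) ∘ₗ J μ := by
    rw [B9Thm313WholeDvFromDds.comp_dv_eq_fsum hDv (ΦY ∘ₗ D ∘ₗ G0)]
    rfl
  rw [heq]
  refine (B9Thm313WholeDvFromDds.hasMaj_fsum_const _ _ _ h3).mono fun a b => ?_
  rw [Finset.card_univ]
  calc (Fintype.card P : ℝ) * (κ₀ * Bi * CJ * c * Real.exp (-(δ₃ * g.dist a b)))
      = (Fintype.card P : ℝ) * (κ₀ * Bi * CJ * c) * Real.exp (-(δ₃ * g.dist a b)) := by ring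
    _ ≤ BhD * Real.exp (-(δ₃ * g.dist a b)) := mul_le_mul_of_nonneg_right hBhD (Real.exp_nonneg _)

end

end Literature.MathematicalPhysics.QuantumFieldTheory.Balaban1983to89.B9Thm313WholeDvHolderFromDdsFree
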